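import Summits.Ventures.QEC.CircuitDistance.PortK2InstBB144CheckX
import Summits.Ventures.QEC.CircuitDistance.PortK2InstBB144CheckZ
import HarnessLib

/-!
# P3-PORT (K2 instance, [[144,12,12]]): class/logical-support facts, `hlog` transport from `PortBB144Logicals`, and the DISCHARGE of
# `K2_BB144_X` / `K2_BB144_Z` GIVEN THE CUBE RUNS — hence `circuitDistance bb144SM Nc = 10` for every `Nc ≥ 1` from the ten
# cube facts `d144X.cube (Ts144X.getD k []) (72k) (lives144X.getD k 0) = true` (k < 5; and Z), eng-1's computational modules
# (cell `qec`, experiment CDX, seat qec-cdx-type-1).  (A₁,A₂,A₃)=(x³,y,y²) per SI p.10 L83; (B₁,B₂,B₃)=(y³,x,x²) per print's positional convention; authors' software labelling = provenance (acq-14097 pending).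
-/

namespace Summit.Ventures.QEC.CircuitDistance

open Literature.InformationTheory.QuantumCodes Finset K2

/-! ## `hlog` transport -/

set_option maxRecDepth 100000 in
/-- The unflattened logical supports are the certificate's `lzVec`. -/
theorem lsuppX144_spec : ∀ j : Fin 12, ∀ q : BB.Mono 12 6 ⊕ BB.Mono 12 6,
    indic (lsuppX144.getD j ∅) q = BB144Log.lzVec j (BB.Code.qubitIndex q) := by decide +kernel

set_option maxRecDepth 20000 in
/-- `hlog` transport (X sector): every nontrivial residual meets one of the 12 logical supports oddly. -/
theorem hlogX144 (v : BB.Mono 12 6 ⊕ BB.Mono 12 6 → ZMod 2)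
    (hz : Matrix.mulVec (fun j q => bb144SM.toCode.HZ j q) v = 0) (hn : v ∉ rowSpace bb144SM.toCode.HX) :
    ∃ s ∈ instX144.lsupp, indic s ⬝ᵥ v ≠ 0 := by
  have hz1 : bb144SM.toCode.HZ.mulVec v = 0 := hz
  rw [bb144SM_toCode] at hz1 hn
  obtain ⟨u, hu⟩ : ∃ u : Fin (12 * 6 + 12 * 6) → ZMod 2, u ∘ (BB.Code.qubitIndex (ℓ := 12) (m := 6)) = v :=
    ⟨v ∘ (BB.Code.qubitIndex (ℓ := 12) (m := 6)).symm,
      funext fun q => by simp only [Function.comp_apply, Equiv.symm_apply_apply]⟩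
  have hz' : Matrix.mulVec BB.bb144.HZFlat u = 0 := by rw [BB.Code.HZFlat_mulVec_eq_zero_iff, hu]; exact hz1
  have hn' : u ∉ rowSpace BB.bb144.HXFlat := fun h => hn (by rw [BB.Code.mem_rowSpace_HXFlat_iff, hu] at h; exact h)
  obtain ⟨j, hj⟩ := BB144Log.hlogX_bb144 u hz' hn'
  have hjl : (j : ℕ) < lsuppX144.length := by
    have := j.2; simp only [lsuppX144, List.length_cons, List.length_nil]; omega
  refine ⟨lsuppX144.getD j ∅, ?_, ?_⟩
  · show lsuppX144.getD j ∅ ∈ lsuppX144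
    rw [List.getD_eq_getElem _ _ hjl]; exact List.getElem_mem _
  · have : BB144Log.lzVec j ⬝ᵥ u = indic (lsuppX144.getD j ∅) ⬝ᵥ v := by
      rw [← hu]
      simp only [dotProduct, Function.comp_apply]
      rw [← Equiv.sum_comp (BB.Code.qubitIndex (ℓ := 12) (m := 6))]
      apply Finset.sum_congr rfl; intro q _
      rw [lsuppX144_spec j q]
    rw [this] at hj; exact hj

set_option maxRecDepth 100000 in
/-- The unflattened logical supports are the certificate's `lxVec`. -/
theorem lsuppZ144_spec : ∀ j : Fin 12, ∀ q : BB.Mono 12 6 ⊕ BB.Mono 12 6,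
    indic (lsuppZ144.getD j ∅) q = BB144Log.lxVec j (BB.Code.qubitIndex q) := by decide +kernel

set_option maxRecDepth 20000 in
/-- `hlog` transport (Z sector): every nontrivial residual meets one of the 12 logical supports oddly. -/
theorem hlogZ144 (v : BB.Mono 12 6 ⊕ BB.Mono 12 6 → ZMod 2)
    (hz : Matrix.mulVec (fun j q => bb144SM.toCode.HX j q) v = 0) (hn : v ∉ rowSpace bb144SM.toCode.HZ) :
    ∃ s ∈ instZ144.lsupp, indic s ⬝ᵥ v ≠ 0 := by
  have hz1 : bb144SM.toCode.HX.mulVec v = 0 := hz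
  rw [bb144SM_toCode] at hz1 hn
  obtain ⟨u, hu⟩ : ∃ u : Fin (12 * 6 + 12 * 6) → ZMod 2, u ∘ (BB.Code.qubitIndex (ℓ := 12) (m := 6)) = v :=
    ⟨v ∘ (BB.Code.qubitIndex (ℓ := 12) (m := 6)).symm,
      funext fun q => by simp only [Function.comp_apply, Equiv.symm_apply_apply]⟩
  have hz' : Matrix.mulVec BB.bb144.HXFlat u = 0 := by rw [BB.Code.HXFlat_mulVec_eq_zero_iff, hu]; exact hz1
  have hn' : u ∉ rowSpace BB.bb144.HZFlat := fun h => hn (by rw [BB.Code.mem_rowSpace_HZFlat_iff, hu] at h; exact h)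
  obtain ⟨j, hj⟩ := BB144Log.hlogZ_bb144 u hz' hn'
  have hjl : (j : ℕ) < lsuppZ144.length := by
    have := j.2; simp only [lsuppZ144, List.length_cons, List.length_nil]; omega
  refine ⟨lsuppZ144.getD j ∅, ?_, ?_⟩
  · show lsuppZ144.getD j ∅ ∈ lsuppZ144
    rw [List.getD_eq_getElem _ _ hjl]; exact List.getElem_mem _
  · have : BB144Log.lxVec j ⬝ᵥ u = indic (lsuppZ144.getD j ∅) ⬝ᵥ v := by
      rw [← hu]
      simp only [dotProduct, Function.comp_apply]
      rw [← Equiv.sum_comp (BB.Code.qubitIndex (ℓ := 12) (m := 6))]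
      apply Finset.sum_congr rfl; intro q _
      rw [lsuppZ144_spec j q]
    rw [this] at hj; exact hj

/-! ## Discharge of the binders from the cube runs -/

set_option maxRecDepth 100000 in
/-- The X classes are listed (kernel). -/
theorem classesX144OK_true : classesX144OK = true := by decide +kernel

/-- **`K2_BB144_X` from the cube runs**: the X-sector representative leaf list of `[[144,12,12]]` is complete, GIVEN the five
cube runs of the checker (eng-1's computational modules). -/
theorem k2_bb144_X
    (hcubes : ∀ k < 5, d144X.cube (Ts144X.getD k []) (72 * k) (lives144X.getD k 0) = true) : K2_BB144_X := by
  intro x hcls hnt hcard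
  have hall := classesX144OK_true
  unfold classesX144OK at hall
  simp only [List.all_eq_true] at hall
  have hx : ∀ g ∈ x, g ∈ instX144.gsupp := by
    intro g hg
    obtain ⟨k, hk, i, hi⟩ := hcls g hg
    have h := hall k hk i (mem_monoList i)
    cases hck : bb144XTable.cls k with
    | none => rw [hck] at hi; exact absurd hi (by simp)
    | some g₀ =>
      rw [hck] at hi h
      simp only [Option.map_some, Option.some.injEq] at hi
      simp only [decide_eq_true_eq] at h
      rw [← hi]; exact h
  obtain ⟨wd, hwd, t, hxt⟩ := K2Inst.k2_completeG (I := instX144) (Hs := bb144SM.toCode.HX) goodX144 hcubes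
    (fun v t j => HZ_mulVec_translate bb144SM v t j) (fun v t hv => rowSpace_HX_translate bb144SM v t hv) hlogX144
    x hx hnt.1 hnt.2 hcard
  obtain ⟨e, he, rfl⟩ := List.mem_map.1 hwd
  exact ⟨e, he, t, hxt⟩

set_option maxRecDepth 100000 in
/-- The Z classes are listed (kernel). -/
theorem classesZ144OK_true : classesZ144OK = true := by decide +kernel

/-- **`K2_BB144_Z` from the cube runs**: the Z-sector representative leaf list of `[[144,12,12]]` is complete, GIVEN the five
cube runs of the checker (eng-1's computational modules). -/
theorem k2_bb144_Z
    (hcubes : ∀ k < 5, d144Z.cube (Ts144Z.getD k []) (72 * k) (lives144Z.getD k 0) = true) : K2_BB144_Z := by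
  intro x hcls hnt hcard
  have hall := classesZ144OK_true
  unfold classesZ144OK at hall
  simp only [List.all_eq_true] at hall
  have hx : ∀ g ∈ x, g ∈ instZ144.gsupp := by
    intro g hg
    obtain ⟨k, hk, i, hi⟩ := hcls g hg
    have h := hall k hk i (mem_monoList i)
    cases hck : bb144ZTable.cls k with
    | none => rw [hck] at hi; exact absurd hi (by simp)
    | some g₀ =>
      rw [hck] at hi h
      simp only [Option.map_some, Option.some.injEq] at hi
      simp only [decide_eq_true_eq] at h
      rw [← hi]; exact h
  obtain ⟨wd, hwd, t, hxt⟩ := K2Inst.k2_completeG (I := instZ144) (Hs := bb144SM.toCode.HZ) goodZ144 hcubes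
    (fun v t j => HX_mulVec_translate bb144SM v t j) (fun v t hv => rowSpace_HZ_translate bb144SM v t hv) hlogZ144
    x hx hnt.1 hnt.2 hcard
  obtain ⟨e, he, rfl⟩ := List.mem_map.1 hwd
  exact ⟨e, he, t, hxt⟩

/-- ★ **`d_circ([[144,12,12]]) = 10` FROM THE CUBE RUNS**: for every `Nc ≥ 1`, given the ten K2 cube facts. -/
theorem bb144_circuitDistance_eq_ten_of_cubes
    (hX : ∀ k < 5, d144X.cube (Ts144X.getD k []) (72 * k) (lives144X.getD k 0) = true)
    (hZ : ∀ k < 5, d144Z.cube (Ts144Z.getD k []) (72 * k) (lives144Z.getD k 0) = true) :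
    ∀ Nc : ℕ, 1 ≤ Nc → circuitDistance bb144SM Nc = 10 :=
  bb144_circuitDistance_eq_ten (k2_bb144_X hX) (k2_bb144_Z hZ)

/-- eng-1's claim `BB144_circuitDistance_eq_ten_claim` from the cube runs. -/
theorem BB144_circuitDistance_eq_ten_claim_of_cubes
    (hX : ∀ k < 5, d144X.cube (Ts144X.getD k []) (72 * k) (lives144X.getD k 0) = true)
    (hZ : ∀ k < 5, d144Z.cube (Ts144Z.getD k []) (72 * k) (lives144Z.getD k 0) = true) :
    BB144_circuitDistance_eq_ten_claim :=
  bb144_claim (k2_bb144_X hX) (k2_bb144_Z hZ)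

/-- `¬ CDX_Q2` from the cube runs. -/
theorem not_CDX_Q2_of_cubes
    (hX : ∀ k < 5, d144X.cube (Ts144X.getD k []) (72 * k) (lives144X.getD k 0) = true)
    (hZ : ∀ k < 5, d144Z.cube (Ts144Z.getD k []) (72 * k) (lives144Z.getD k 0) = true) : ¬ CDX_Q2 :=
  bb144_not_CDX_Q2 (k2_bb144_X hX) (k2_bb144_Z hZ)

end Summit.Ventures.QEC.CircuitDistance
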